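import Literature.Topology.PlaneTopology.Crosscut
import HarnessLib

/-!
# Crux `SAWDevelopingMap.ObservableToSLE` (stmt-CriticalPhenomena-10472), line `six-class-type-ladder`,
stub T2b′ `stub_carvedReduction_squeeze`: piece (G4′), RE-PARAMETRISING THE BOUNDARY LOOP OF A
DOBRUSHIN DOMAIN

Landing target:
`Summits/CriticalPhenomena/SAWScalingLimit/Theorems/SAWDevelopingMapObservableToSLETypeLadderCarvedReductionSqueezeReparam.lean`
(`--supports stmt-CriticalPhenomena-10472`; registered sub-goal `stub_carvedReduction_reparam`).

The moving-carving squeeze asks for a FIXED two-piece flat Dobrushin domain `M` whose boundary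
PARAMETRISATION is `η`-close to that of `D`: `∀ t, dist (M.boundary t + τ) (D.boundary t) ≤ η`,
with the marked points close as well.  The approximant `M` is produced by cutting and swallowing
(Newman, Carathéodory), with whatever boundary loop those constructions give; the closeness is a
FRÉCHET statement, i.e. it holds after re-parametrising the loop of `M` by an orientation
compatible circle homeomorphism matching the two marks.  This file provides the re-parametrisation:

* `stub_carvedReduction_reparam` — for a Dobrushin domain `M`, a continuous strictly increasing
  surjection `h : ℝ → ℝ` with `h (t + 1) = h t + 1`, and parameters `0 ≤ c₀ < c₁ < 1` sent by `h`
  to the marks of `M` (up to a common integer), there is a Dobrushin domain with the same carrier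
  and marked points, boundary loop `M.boundary ∘ h` and marks `c₀, c₁`.
-/

noncomputable section

open Set Function
open Literature.Probability.RandomPlanarGeometry

namespace Summit.CriticalPhenomena.SAWScalingLimit.Theorems.ObservableToSLE.TypeLadder

/-- **Registered sub-goal `stub_carvedReduction_reparam`** (crux item stmt-CriticalPhenomena-10472,
stub T2b′ `stub_carvedReduction_squeeze`, piece (G4′) RE-PARAMETRISATION): see the module docstring.
[cite: Newman1939, Ch. V §11] -/
theorem stub_carvedReduction_reparam :
    ∀ (M : DobrushinDomain) (h : ℝ → ℝ) (c₀ c₁ : ℝ) (z : ℤ),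
      Continuous h → StrictMono h → Function.Surjective h → (∀ t, h (t + 1) = h t + 1) →
      0 ≤ c₀ → c₀ < c₁ → c₁ < 1 → h c₀ = M.mark 0 + z → h c₁ = M.mark 1 + z →
      ∃ M₂ : DobrushinDomain, M₂.carrier = M.carrier ∧ (∀ t, M₂.boundary t = M.boundary (h t)) ∧
        M₂.mark 0 = c₀ ∧ M₂.mark 1 = c₁ ∧ M₂.pt 0 = M.pt 0 ∧ M₂.pt 1 = M.pt 1 := by
  intro M h c₀ c₁ z hc hmono hsurj hper hc₀ hc₀₁ hc₁ hm₀ hm₁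
  classical
  have hperM := M.periodic_boundary
  -- shifting the parameter of `M.boundary` by an integer
  have hshift : ∀ (u : ℝ), M.boundary (u + z) = M.boundary u := fun u ↦ by
    simpa using hperM.int_mul z u
  -- `h` maps `[0, 1)` into the period `[h 0, h 0 + 1)`
  have hmaps : ∀ {s : ℝ}, s ∈ Ico (0 : ℝ) 1 → h s ∈ Ico (h 0) (h 0 + 1) := fun {s} hs ↦ by
    refine ⟨hmono.monotone hs.1, ?_⟩
    rw [← hper 0, zero_add]
    exact hmono hs.2
  let M₂ : DobrushinDomain :=
    { carrier := M.carrier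
      boundary := fun t ↦ M.boundary (h t)
      isOpen := M.isOpen
      isBounded := M.isBounded
      isConnected := M.isConnected
      continuous_boundary := M.continuous_boundary.comp hc
      periodic_boundary := fun t ↦ by
        show M.boundary (h (t + 1)) = M.boundary (h t)
        rw [hper]; exact hperM (h t)
      injOn_boundary := by
        intro s hs t ht hst
        have := M.injOn_boundary_Ico (h 0) (hmaps hs) (hmaps ht) hst
        exact hmono.injective this
      range_boundary := by
        rw [show (fun t ↦ M.boundary (h t)) = M.boundary ∘ h from rfl, hsurj.range_comp,
          M.range_boundary]
      mark := ![c₀, c₁]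
      strictMono_mark := by
        refine Fin.strictMono_iff_lt_succ.2 fun k ↦ ?_
        fin_cases k
        simpa using hc₀₁
      mark_mem := fun k ↦ by
        fin_cases k
        · exact ⟨hc₀, hc₀₁.trans hc₁⟩
        · exact ⟨hc₀.trans hc₀₁.le, hc₁⟩ }
  refine ⟨M₂, rfl, fun t ↦ rfl, rfl, rfl, ?_, ?_⟩
  · show M.boundary (h c₀) = M.boundary (M.mark 0)
    rw [hm₀, hshift]
  · show M.boundary (h c₁) = M.boundary (M.mark 1)
    rw [hm₁, hshift]

/-- A continuous `h` with `h (t + 1) = h t + 1` is surjective (intermediate value theorem; so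
the surjectivity hypothesis of `stub_carvedReduction_reparam` is automatic). -/
theorem surjective_of_periodic_shift {h : ℝ → ℝ} (hc : Continuous h)
    (hper : ∀ t, h (t + 1) = h t + 1) : Surjective h := by
  have hint : ∀ (n : ℕ) (t : ℝ), h (t + n) = h t + n := by
    intro n
    induction n with
    | zero => intro t; simp
    | succ n ih => intro t; push_cast; rw [← add_assoc, hper, ih]; ring
  have hint' : ∀ (n : ℕ) (t : ℝ), h (t - n) = h t - n := by
    intro n t
    have := hint n (t - n)
    rw [sub_add_cancel] at this
    linarith
  intro y
  obtain ⟨n, hn⟩ := exists_nat_ge |y - h 0|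
  have h1 : h (0 - n) ≤ y := by
    rw [hint' n 0]; linarith [neg_abs_le (y - h 0)]
  have h2 : y ≤ h (0 + n) := by
    rw [hint n 0]; linarith [le_abs_self (y - h 0)]
  exact intermediate_value_univ (f := h) (0 - (n : ℝ)) (0 + (n : ℝ)) hc ⟨h1, h2⟩

end Summit.CriticalPhenomena.SAWScalingLimit.Theorems.ObservableToSLE.TypeLadder

end
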